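import Literature.Barriers.CriticalPhenomena.PositionSpaceRGNonGibbsianFiniteVolume
import Literature.Barriers.CriticalPhenomena.PositionSpaceRGNonGibbsianExtremal
import HarnessLib

/-!
# van Enter–Fernández–Sokal 1993, Theorem 4.2 line, layer 3: Step 3 ("unfixing of the spin at
# the origin", eqs. (4.7)–(4.12)) and the FKG reduction to the worst boundary condition, proved —
# the finite-volume estimate `VEFS1993_eq413` from the uniform gap `VEFS1993_eq412`

Fourth companion file of `Literature/Barriers/CriticalPhenomena/PositionSpaceRGNonGibbsian.lean`
(barrier = Theorem 4.2 of van Enter–Fernández–Sokal, J. Stat. Phys. 72 (1993) 879,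
arXiv:hep-lat/9210032). The chain so far (all proved): `VEFS1993_eq413 → VEFS1993_eq432 →
VEFS1993_thm42 = PositionSpaceRGNonGibbsian` (`PositionSpaceRGNonGibbsianFiniteVolume.lean`,
`…Proofs.lean`). Here `VEFS1993_eq413` (the uniform finite-volume bound on `⟨σ_0⟩^η_W` over all
boundary conditions `η` with `T₂η ∈ 𝒩_{R,R',±}`) is reduced to `VEFS1993_eq412`, a uniform lower
bound on ONE difference of two expectations in two completely specified finite-volume Ising
systems (no quantifier over boundary conditions left): Step 3 of the printed proof and the FKG
"worst case" reduction of Step 2, eqs. (4.26)–(4.27), are proved. D-0014: nothing is asserted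
except the named fact `VEFS1993_eq412 : Prop`.

## What the source prints (§4.1.2 pp. 99–100, §4.3.1 pp. 109–112 of the arXiv preprint)

* §4.3.1 Step 2, (4.26)–(4.27) (p. 109): "`⟨σ_i⟩^{alt;+;ω̃}_{R,R'} ≥ ⟨σ_i⟩^{alt;+;-}_{R,R'} ≥ c > 0`
  (4.26) and by symmetry `⟨σ_i⟩^{alt;-;ω̃}_{R,R'} ≤ ⟨σ_i⟩^{alt;-;+}_{R,R'} ≤ -c < 0` (4.27) for
  every configuration `ω̃` outside `Λ_{R'}` … This will be proven using correlation inequalities"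
  — the first inequality in each line is the FKG monotonicity in the boundary condition (the
  arbitrary spins `ω̃`, image and internal, replaced by all `-`, resp. all `+`).
* §4.1.2 Step 3 (pp. 99–100), "Unfixing of the spin at the origin": "the system we really want
  to study is the system consisting of the internal spins in `Λ_{R+2}` and the spin at the
  origin, with the image spins in `Λ^image_R` other than the one at the origin fixed in the
  alternating configuration `ω'_alt`, the image spins in layer `Γ^image_{R+2}` set to be `+`, and
  the spins outside `Λ_{R+2}` (both image and internal) fixed in some arbitrary configuration.
  … Denoting by `⟨·⟩₊` (resp. `⟨·⟩'₊`) the expectation in the old (resp. new) decorated system,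
  it is easy to see that
  `⟨σ_{0,0}⟩'₊ = [1 - ⟨exp[-2J(σ_{0,1}+σ_{0,-1}+σ_{1,0}+σ_{-1,0})]⟩₊] /
                 [1 + ⟨exp[-2J(σ_{0,1}+σ_{0,-1}+σ_{1,0}+σ_{-1,0})]⟩₊]` (4.7).
  Similarly, for the analogous system with the image spins in `Γ^image_{R+2}` set to `-`, we
  have `⟨σ_{0,0}⟩'₋ = [1 - ⟨exp[+2J(…)]⟩₊] / [1 + ⟨exp[+2J(…)]⟩₊]` (4.8). Therefore
  `⟨σ_{0,0}⟩'₊ - ⟨σ_{0,0}⟩'₋ = 2(y - x) / ((1+x)(1+y))` (4.9), where `x = ⟨exp[-2J(…)]⟩₊` (4.10),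
  `y = ⟨exp[+2J(…)]⟩₊` (4.11). Now `y - x = 2⟨sinh 2J(…)⟩₊ … ≥ 16J⟨σ_{0,1}⟩₊` (4.12) … the
  denominator in (4.9) is bounded between `1` and `(1 + e^{8J})²`. … we can conclude that
  `⟨σ_{0,0}⟩'₊ - ⟨σ_{0,0}⟩'₋ ≥ δ > 0` (4.13) uniformly in `R` (sufficiently large) and in the
  configuration outside"; footnote 48: "Because we have fixed the image spin at the origin to be
  `+`, the two situations are not quite symmetric. But the only change is a shift in the location
  of the internal spins in `∂_{R+1}` which feel a nonzero effective field; and this is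
  irrelevant, since we replace these fields by zero anyway."
* §4.3.1 Step 3 (p. 112): "Finally, we can 'unfix' the spin at the origin in the same way as in
  the 2-dimensional example."

## What is formalised (namespace `Literature.Barriers.CriticalPhenomena.NonGibbs`)

General finite-volume Ising facts (any locally finite graph `G`, proved):
* `isingExpect_fixed_neg`: global spin-flip symmetry `⟨f⟩^{-η}_{Λ;β,-h} = ⟨f(-·)⟩^{η}_{Λ;β,h}`.
* `isingExpect_bcTiltFactor`: `⟨R_{η₁→η₂}⟩^{η₁} = Z^{η₂}/Z^{η₁}` for the boundary tilt factor.
* `isingExpect_spinAt_eq_unfix` — **(4.7)**: if `a ∈ Λ` and all neighbours of `a` lie in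
  `Λ ∖ {a}`, then for a boundary condition `ζ` with `ζ_a = +1`,
  `⟨σ_a⟩^ζ_{Λ;β,0} = (1 - x)/(1 + x)` with `x = ⟨exp(-2β ∑_{y∼a} σ_y)⟩^{ζ}_{Λ∖{a};β,0}` (the
  system with the spin at `a` frozen to `+`).
The `b = 2` objects of §4.3.1: `gpiVolume' d R'` (the internal spins of the cube
`Λ_{R'} = box d (2R')`), `nbrSpinSum` (the sum of the `2d` spins neighbouring the origin), and
the extremal boundary conditions `coreAnnulusBC d 2 R R' 1 (-1)` / `coreAnnulusBC d 2 R R' (-1) 1`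
of `PositionSpaceRGNonGibbsianExtremal.lean` (Theorem 4.3 line; image spins `ω'_alt` on `Λ'_R`,
`±1` on the annulus, `∓1` everywhere else).
* Named fact (NOT proved): `VEFS1993_eq412` — the uniform gap `y - x ≥ η > 0` of (4.12)–(4.13)
  in `d ≥ 3`, with `x` of (4.10) computed in the worst-case system of (4.26) and `y` of (4.11)
  in the (flipped) worst-case system of (4.27), cf. footnote 48.
* PROVED: `VEFS1993_eq413_of_eq412 : VEFS1993_eq412 → VEFS1993_eq413` — FKG monotonicity in
  the boundary condition (`isingExpect_fixed_mono`, Friedli–Velenik Exercise 3.13, proved in the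
  tree) reduces every admissible `η` to the worst case; (4.7)/(4.8) via
  `isingExpect_spinAt_eq_unfix` and the spin flip; (4.9) and the bound on its denominator give
  `c₊ - c₋ ≥ 2η/(1 + e^{2β·2d})² =: δ`. Hence `VEFS1993_eq432_of_eq412`,
  `VEFS1993_thm42_of_eq412`, `positionSpaceRGNonGibbsian_of_eq412`.

What remains for the barrier is `VEFS1993_eq412` (Steps 1 and 2.1–2.4 of §4.3.1 with (4.12)).
-/

noncomputable section

namespace Literature.Barriers.CriticalPhenomena.NonGibbs

open MeasureTheory Finset Literature.Probability.LatticeModels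

/-! ### Finite-volume Ising identities on a general graph -/

section General

variable {V : Type*} (G : SimpleGraph V) [DecidableEq V] [G.LocallyFinite]

/-- The sum of the spins neighbouring `a`: `∑_{y ∼ a} σ_y` (the exponent
`σ_{0,1}+σ_{0,-1}+σ_{1,0}+σ_{-1,0}` of (4.7) for `ℤ²`). [cite: VanenterFernandezSokal1993, eq. (4.7)] -/
def nbrSpinSum (a : V) (σ : SpinConfig V) : ℝ :=
  ∑ y ∈ G.neighborFinset a, spinAt y σ

omit [DecidableEq V] in
/-- `nbrSpinSum` is measurable. [cite: FriedliVelenik2017, §6.2] -/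
@[fun_prop]
theorem measurable_nbrSpinSum (a : V) : Measurable (nbrSpinSum G a) :=
  Finset.measurable_sum _ fun y _ => measurable_spinAt y

omit [DecidableEq V] in
/-- `nbrSpinSum` is nondecreasing (FKG order). [cite: FriedliVelenik2017, §3.6.2] -/
theorem nbrSpinSum_mono (a : V) : Monotone (nbrSpinSum G a) :=
  fun _ _ h => Finset.sum_le_sum fun y _ => spinAt_mono y h

omit [DecidableEq V] in
/-- `|∑_{y∼a} σ_y| ≤ deg a`. [cite: FriedliVelenik2017, §3.1] -/
theorem abs_nbrSpinSum_le (a : V) (σ : SpinConfig V) :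
    |nbrSpinSum G a σ| ≤ (G.neighborFinset a).card := by
  unfold nbrSpinSum
  calc |∑ y ∈ G.neighborFinset a, spinAt y σ| ≤ ∑ y ∈ G.neighborFinset a, |spinAt y σ| :=
        Finset.abs_sum_le_sum_abs _ _
    _ ≤ ∑ _y ∈ G.neighborFinset a, (1 : ℝ) := Finset.sum_le_sum fun y _ => by
        rcases spinAt_eq_one_or_eq_neg_one y σ with h | h <;> simp [h]
    _ = (G.neighborFinset a).card := by simp

omit [DecidableEq V] in
/-- Spin flip: `∑_{y∼a} (-σ)_y = -∑_{y∼a} σ_y`. [cite: FriedliVelenik2017, §3.7.1] -/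
theorem nbrSpinSum_neg (a : V) (σ : SpinConfig V) : nbrSpinSum G a (-σ) = -nbrSpinSum G a σ := by
  simp [nbrSpinSum, spinAt_neg]

omit [DecidableEq V] [G.LocallyFinite] in
/-- The global spin flip is measurable on `SpinConfig V`. [cite: FriedliVelenik2017, §6.2] -/
theorem measurable_neg_spinConfig : Measurable fun σ : SpinConfig V => -σ :=
  measurable_pi_lambda _ fun x =>
    (measurable_of_countable fun u : ℤˣ => -u).comp (measurable_pi_apply x)

/-- **Global spin-flip symmetry of finite-volume expectations** (Friedli–Velenik 2017, §3.7.1):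
`⟨f⟩^{-η}_{Λ;β,-h} = ⟨f(-·)⟩^{η}_{Λ;β,h}` for a fixed boundary condition `η` and measurable `f`.
[cite: FriedliVelenik2017, §3.7.1] -/
theorem isingExpect_fixed_neg (Λ : Finset V) (β h : ℝ) (η : SpinConfig V)
    {f : SpinConfig V → ℝ} (hf : Measurable f) :
    isingExpect G Λ β (-h) (.fixed (-η)) f = isingExpect G Λ β h (.fixed η) (fun σ => f (-σ)) := by
  have hfn : Measurable fun σ : SpinConfig V => f (-σ) := hf.comp measurable_neg_spinConfig
  rw [isingExpect, isingExpect, integral_isingMeasure G Λ β (-h) _ hf,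
    integral_isingMeasure G Λ β h _ hfn,
    show (BoundaryCondition.fixed (-η)) = (BoundaryCondition.fixed η).flip from rfl,
    isingPartitionFunction_flip]
  congr 1
  rw [← Equiv.sum_comp (Equiv.neg (Λ → ℤˣ))]
  refine Finset.sum_congr rfl fun τ _ => ?_
  rw [Equiv.neg_apply, isingWeight_neg_flip, BoundaryCondition.flip_fixed, glue_neg_fixed]

/-- **The boundary tilt factor integrates to the ratio of partition functions**:
`⟨R_{η₁→η₂}⟩^{η₁}_{Λ;β,h} = Z^{η₂}_{Λ;β,h} / Z^{η₁}_{Λ;β,h}` (Friedli–Velenik 2017, proof of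
Lemma 3.23: `⟨I⟩^∅ = Z⁺/Z^∅`). [cite: FriedliVelenik2017, proof of Lemma 3.23] -/
theorem isingExpect_bcTiltFactor (Λ : Finset V) (β h : ℝ) (η₁ η₂ : SpinConfig V) :
    isingExpect G Λ β h (.fixed η₁) (bcTiltFactor G Λ β h η₁ η₂) =
      isingPartitionFunction G Λ β h (.fixed η₂) / isingPartitionFunction G Λ β h (.fixed η₁) := by
  rw [isingExpect, integral_isingMeasure G Λ β h _ (measurable_bcTiltFactor G Λ β h η₁ η₂)]
  congr 1
  simp only [isingPartitionFunction]
  refine Finset.sum_congr rfl fun τ _ => ?_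
  rw [isingWeight_fixed_eq_mul_bcTiltFactor G Λ β h η₁ η₂ τ]

omit [G.LocallyFinite] in
/-- A sum over the configurations of a one-site volume `S = {a}` has two terms.
[cite: FriedliVelenik2017, §3.1] -/
theorem sum_config_of_forall_eq {S : Finset V} {a : V} (ha : a ∈ S) (hS : ∀ x ∈ S, x = a)
    (Φ : (↥S → ℤˣ) → ℝ) : ∑ τ, Φ τ = Φ (fun _ => 1) + Φ (fun _ => -1) := by
  have hconst : ∀ τ : ↥S → ℤˣ, (fun _ : ↥S => τ ⟨a, ha⟩) = τ := fun τ => funext fun x => by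
    have hx : x = ⟨a, ha⟩ := Subtype.ext (hS x x.2)
    rw [hx]
  let e : (↥S → ℤˣ) ≃ ℤˣ :=
    { toFun := fun τ => τ ⟨a, ha⟩
      invFun := fun u _ => u
      left_inv := fun τ => hconst τ
      right_inv := fun u => rfl }
  rw [← e.symm.sum_comp Φ]
  show ∑ u : ℤˣ, Φ (fun _ => u) = _
  rw [show (Finset.univ : Finset ℤˣ) = {1, -1} from rfl, Finset.sum_pair (by decide)]

omit [G.LocallyFinite] in
/-- Gluing the one-site configuration `u` on `Λ ∖ (Λ ∖ {a}) = {a}` into `ζ` is updating `ζ` at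
`a`. [cite: FriedliVelenik2017, §3.1] -/
theorem glue_sdiff_erase_const {Λ : Finset V} {a : V} (ha : a ∈ Λ) (u : ℤˣ) (ζ : SpinConfig V) :
    glue (Λ \ Λ.erase a) (fun _ => u) (.fixed ζ) = Function.update ζ a u := by
  funext x
  by_cases hx : x = a
  · subst hx
    rw [glue_apply_of_mem _ _ _ (by simp [ha]), Function.update_self]
  · rw [glue_apply_of_notMem _ _ _ (by simp [hx]), Function.update_of_ne hx]
    rfl

/-- If all neighbours of `a` lie in `Λ ∖ {a}`, every edge touching `Λ` touches `Λ ∖ {a}`.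
[cite: FriedliVelenik2017, §3.1 eq. (3.6)] -/
theorem edgesTouching_sdiff_erase_eq_empty {Λ : Finset V} {a : V}
    (hN : ∀ y, G.Adj a y → y ∈ Λ.erase a) :
    edgesTouching G Λ \ edgesTouching G (Λ.erase a) = ∅ := by
  refine Finset.sdiff_eq_empty_iff_subset.2 fun e he => ?_
  induction e using Sym2.ind with
  | _ u v =>
    rw [mem_edgesTouching_iff] at he ⊢
    obtain ⟨he, x, hx, hxe⟩ := he
    refine ⟨he, ?_⟩
    have hadj : G.Adj u v := by simpa using he
    by_cases hxa : x = a
    · subst hxa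
      rcases Sym2.mem_iff.1 hxe with rfl | rfl
      · exact ⟨v, hN v hadj, Sym2.mem_mk_right _ _⟩
      · exact ⟨u, hN u hadj.symm, Sym2.mem_mk_left _ _⟩
    · exact ⟨x, Finset.mem_erase.2 ⟨hxa, hx⟩, hxe⟩

/-- **The tilt factor of the spin flip at `a`**: for `a ∉ Λ'` with all its neighbours in `Λ'`
and `ζ_a = +1`, the boundary tilt factor from `ζ` to `ζ[a ↦ -1]` is
`exp(-2β ∑_{y∼a} σ_y)` (the integrand of (4.7)/(4.10)).
[cite: VanenterFernandezSokal1993, eqs. (4.7) and (4.10)] -/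
theorem bcTiltFactor_update_neg_one {Λ' : Finset V} {a : V} (ha : a ∉ Λ')
    (hN : ∀ y, G.Adj a y → y ∈ Λ') (β : ℝ) {ζ : SpinConfig V} (hζ : ζ a = 1)
    (σ : SpinConfig V) :
    bcTiltFactor G Λ' β 0 ζ (Function.update ζ a (-1)) σ =
      Real.exp (-(2 * β * nbrSpinSum G a σ)) := by
  unfold bcTiltFactor
  congr 1
  rw [neg_mul, ← mul_neg, neg_isingHamiltonian_reglue_sub]
  set ρm : SpinConfig V := reglue Λ' (Function.update ζ a (-1)) σ with hρm
  set ρp : SpinConfig V := reglue Λ' ζ σ with hρp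
  -- the two re-glued configurations agree off `a`
  have hagree : ∀ x, x ≠ a → ρm x = ρp x := by
    intro x hx
    by_cases hxΛ : x ∈ Λ'
    · rw [hρm, hρp, reglue_apply_of_mem _ _ _ hxΛ, reglue_apply_of_mem _ _ _ hxΛ]
    · rw [hρm, hρp, reglue_apply_of_notMem _ _ _ hxΛ, reglue_apply_of_notMem _ _ _ hxΛ,
        Function.update_of_ne hx]
  have hρma : ρm a = -1 := by
    rw [hρm, reglue_apply_of_notMem _ _ _ ha, Function.update_self]
  have hρpa : ρp a = 1 := by
    rw [hρp, reglue_apply_of_notMem _ _ _ ha, hζ]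
  -- only the edges at `a` contribute
  set g : Sym2 V → ℝ := fun e => bondSpin ρm e - bondSpin ρp e with hg
  have hzero : ∀ e ∈ edgesTouching G Λ', a ∉ e → g e = 0 := by
    intro e _ hae
    induction e using Sym2.ind with
    | _ u v =>
      have hu : u ≠ a := fun h => hae (h ▸ Sym2.mem_mk_left _ _)
      have hv : v ≠ a := fun h => hae (h ▸ Sym2.mem_mk_right _ _)
      simp only [hg, bondSpin_mk, spinAt, hagree u hu, hagree v hv, sub_self]
  have hfilter : (edgesTouching G Λ').filter (fun e => a ∈ e) =
      (G.neighborFinset a).image fun y => s(a, y) := by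
    ext e
    simp only [Finset.mem_filter, mem_edgesTouching_iff, Finset.mem_image,
      SimpleGraph.mem_neighborFinset]
    constructor
    · rintro ⟨⟨he, x, hx, hxe⟩, hae⟩
      induction e using Sym2.ind with
      | _ u v =>
        have hadj : G.Adj u v := by simpa using he
        rcases Sym2.mem_iff.1 hae with rfl | rfl
        · exact ⟨v, hadj, rfl⟩
        · exact ⟨u, hadj.symm, Sym2.eq_swap⟩
    · rintro ⟨y, hy, rfl⟩
      exact ⟨⟨by simpa using hy, y, hN y hy, Sym2.mem_mk_right _ _⟩, Sym2.mem_mk_left _ _⟩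
  have hsum : ∑ e ∈ edgesTouching G Λ', g e = ∑ y ∈ G.neighborFinset a, g s(a, y) := by
    rw [← Finset.sum_subset (Finset.filter_subset (fun e => a ∈ e) (edgesTouching G Λ'))
      (fun e he hnot => hzero e he fun hae => hnot (Finset.mem_filter.2 ⟨he, hae⟩)),
      hfilter, Finset.sum_image]
    intro y _ y' _ h
    exact Sym2.congr_right.1 h
  have hterm : ∀ y ∈ G.neighborFinset a, g s(a, y) = -2 * spinAt y σ := by
    intro y hy
    have hyΛ : y ∈ Λ' := hN y ((SimpleGraph.mem_neighborFinset _ _ _).1 hy)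
    have hy' : ρm y = σ y := by rw [hρm, reglue_apply_of_mem _ _ _ hyΛ]
    have hy'' : ρp y = σ y := by rw [hρp, reglue_apply_of_mem _ _ _ hyΛ]
    simp only [hg, bondSpin_mk, spinAt, hρma, hρpa, hy', hy'', Units.val_neg, Units.val_one,
      Int.cast_neg, Int.cast_one]
    ring
  change β * ∑ e ∈ edgesTouching G Λ', g e = -(2 * β * nbrSpinSum G a σ)
  rw [hsum, Finset.sum_congr rfl hterm, nbrSpinSum, Finset.mul_sum, Finset.mul_sum,
    ← Finset.sum_neg_distrib]
  refine Finset.sum_congr rfl fun y _ => ?_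
  ring

/-- **"Unfixing of the spin at the origin", eq. (4.7)** (van Enter–Fernández–Sokal §4.1.2
Step 3; for `ℤ^d`, §4.3.1 Step 3): let `a ∈ Λ` have all its neighbours in `Λ ∖ {a}` and let the
boundary condition `ζ` carry `ζ_a = +1`. Then the zero-field expectation of `σ_a` in `Λ` is
`⟨σ_a⟩^ζ_{Λ;β,0} = (1 - x)/(1 + x)` with `x = ⟨exp(-2β ∑_{y∼a} σ_y)⟩^{ζ}_{Λ∖{a};β,0}`, the
expectation in the system where the spin at `a` is frozen to `+1` ("`⟨·⟩₊` the expectation in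
the old decorated system"). Proof as printed: split the configurations of `Λ` according to
`σ_a = ±1`; the two halves are the systems in `Λ ∖ {a}` with `a` frozen to `±1`, whose partition
functions `Z₊, Z₋` give `⟨σ_a⟩ = (Z₊ - Z₋)/(Z₊ + Z₋)` and `Z₋/Z₊ = ⟨exp(-2β ∑_{y∼a} σ_y)⟩₊`.
[cite: VanenterFernandezSokal1993, §4.1.2 Step 3, eqs. (4.7) and (4.10)] -/
theorem isingExpect_spinAt_eq_unfix {Λ : Finset V} {a : V} (ha : a ∈ Λ)
    (hN : ∀ y, G.Adj a y → y ∈ Λ.erase a) (β : ℝ) {ζ : SpinConfig V} (hζ : ζ a = 1) :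
    isingExpect G Λ β 0 (.fixed ζ) (spinAt a) =
      (1 - isingExpect G (Λ.erase a) β 0 (.fixed ζ)
          (fun σ => Real.exp (-(2 * β * nbrSpinSum G a σ)))) /
      (1 + isingExpect G (Λ.erase a) β 0 (.fixed ζ)
          (fun σ => Real.exp (-(2 * β * nbrSpinSum G a σ)))) := by
  set Λ' := Λ.erase a with hΛ'
  have hsub : Λ' ⊆ Λ := Finset.erase_subset a Λ
  have ha' : a ∉ Λ' := Finset.notMem_erase a Λ
  have haS : a ∈ Λ \ Λ' := Finset.mem_sdiff.2 ⟨ha, ha'⟩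
  have hS : ∀ x ∈ Λ \ Λ', x = a := fun x hx => by
    by_contra hxa
    exact (Finset.mem_sdiff.1 hx).2 (Finset.mem_erase.2 ⟨hxa, (Finset.mem_sdiff.1 hx).1⟩)
  set Zp := isingPartitionFunction G Λ' β 0 (.fixed ζ) with hZp
  set Zm := isingPartitionFunction G Λ' β 0 (.fixed (Function.update ζ a (-1))) with hZm
  have hZp_pos : 0 < Zp := isingPartitionFunction_pos G Λ' β 0 _
  have hZm_pos : 0 < Zm := isingPartitionFunction_pos G Λ' β 0 _
  have hupd1 : Function.update ζ a 1 = ζ := by rw [← hζ, Function.update_eq_self]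
  have hE : edgesTouching G Λ \ edgesTouching G Λ' = ∅ := edgesTouching_sdiff_erase_eq_empty G hN
  have hglue : ∀ u : ℤˣ, glue (Λ \ Λ') (fun _ => u) (.fixed ζ) = Function.update ζ a u :=
    fun u => glue_sdiff_erase_const ha u ζ
  have hin : ∀ (ξ : SpinConfig V) (τ₁ : Λ' → ℤˣ), spinAt a (glue Λ' τ₁ (.fixed ξ)) = spinAt a ξ :=
    fun ξ τ₁ => by simp only [spinAt, glue_apply_of_notMem _ _ _ ha']; rfl
  have hs1 : spinAt a ζ = 1 := by simp [spinAt, hζ]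
  have hs2 : spinAt a (Function.update ζ a (-1)) = -1 := by simp [spinAt]
  -- numerator: `∑_τ w(τ) σ_a(τ ∨ ζ) = Z₊ - Z₋`
  have hnum : ∑ τ : Λ → ℤˣ, isingWeight G Λ β 0 (.fixed ζ) τ * spinAt a (glue Λ τ (.fixed ζ)) =
      Zp - Zm := by
    rw [sum_isingWeight_fixed_eq_sum_sum G hsub ζ β 0 (spinAt a), sum_config_of_forall_eq haS hS]
    simp only [hE, Finset.sum_empty, zero_mul, add_zero, mul_zero, Real.exp_zero, one_mul,
      hglue, hupd1, hin, hs1, hs2, mul_one, mul_neg_one, Finset.sum_neg_distrib]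
    rfl
  -- denominator: `Z = Z₊ + Z₋`
  have hden : isingPartitionFunction G Λ β 0 (.fixed ζ) = Zp + Zm := by
    rw [isingPartitionFunction_fixed_eq_sum G hsub ζ β 0, sum_config_of_forall_eq haS hS]
    simp only [hE, Finset.sum_empty, zero_mul, add_zero, mul_zero, Real.exp_zero, one_mul,
      hglue, hupd1]
    rfl
  -- `x = Z₋/Z₊`
  have hx : isingExpect G Λ' β 0 (.fixed ζ) (fun σ => Real.exp (-(2 * β * nbrSpinSum G a σ))) =
      Zm / Zp := by
    have hN' : ∀ y, G.Adj a y → y ∈ Λ' := hN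
    have : (fun σ => Real.exp (-(2 * β * nbrSpinSum G a σ))) =
        bcTiltFactor G Λ' β 0 ζ (Function.update ζ a (-1)) :=
      funext fun σ => (bcTiltFactor_update_neg_one G ha' hN' β hζ σ).symm
    rw [this, isingExpect_bcTiltFactor]
  rw [isingExpect, integral_isingMeasure G Λ β 0 _ (measurable_spinAt a), hnum, hden, hx]
  field_simp

end General

/-! ### The `b = 2` objects of §4.3.1: the internal volume -/

section Objects

variable (d : ℕ)

/-- **The internal-spin volume `Λ^int_{R'}`** (§4.3.1 Step 2): the sites of the cube
`Λ_{R'} = box d (2R')` of the original lattice off the decimated sublattice `2ℤ^d` (so the origin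
is excluded: the system "with the spin at the origin frozen", `⟨·⟩₊` of (4.7)).
[cite: VanenterFernandezSokal1993, §4.3.1 Step 2] -/
def gpiVolume' (R' : ℕ) : Finset (Site d) :=
  (box d (2 * R')).filter fun x => ¬ ∀ i, (2 : ℤ) ∣ x i

variable {d}

/-- The origin is not an internal site. [cite: VanenterFernandezSokal1993, §4.3.1 Step 2] -/
theorem zero_notMem_gpiVolume' (R' : ℕ) : (0 : Site d) ∉ gpiVolume' d R' := by
  simp [gpiVolume']

/-- No decimated site is internal. [cite: VanenterFernandezSokal1993, §4.3.1 Step 2] -/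
theorem double_notMem_gpiVolume' (R' : ℕ) (x : Site d) :
    (fun i => ((2 : ℕ) : ℤ) * x i) ∉ gpiVolume' d R' := by
  simp only [gpiVolume', Finset.mem_filter, not_and, not_not]
  intro _ i
  exact ⟨x i, by simp⟩

/-- For `R' ≥ 1` the `2d` neighbours of the origin are internal sites of `Λ_{R'}`.
[cite: VanenterFernandezSokal1993, §4.1.2 Step 3] -/
theorem mem_gpiVolume'_of_adj_zero {R' : ℕ} (hR' : 1 ≤ R') {y : Site d} (hy : (zdGraph d).Adj 0 y) :
    y ∈ gpiVolume' d R' := by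
  rw [zdGraph_adj_iff] at hy
  obtain ⟨i, hi⟩ := hy
  simp only [gpiVolume', Finset.mem_filter, mem_box]
  rcases hi with h | h
  · have hy : y = Pi.single i 1 := by simpa using h
    subst hy
    refine ⟨fun j => ?_, fun hall => ?_⟩
    · by_cases hj : j = i
      · subst hj; simp; omega
      · simp [Pi.single_eq_of_ne hj]
    · have := hall i
      simp at this
  · have hy : y = -Pi.single i 1 := by
      have := congrFun h
      funext j
      have hj := this j
      simp only [Pi.zero_apply, Pi.add_apply] at hj
      simp only [Pi.neg_apply]
      linarith
    subst hy
    refine ⟨fun j => ?_, fun hall => ?_⟩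
    · by_cases hj : j = i
      · subst hj; simp; omega
      · simp [Pi.single_eq_of_ne hj]
    · have := hall i
      simp at this

/-- The extremal boundary conditions of (4.26)–(4.27) carry `ω'_alt(0) = +1` at the origin.
[cite: VanenterFernandezSokal1993, §4.1.2 Step 3] -/
theorem coreAnnulusBC_two_zero (R R' : ℕ) (s_ann s_out : ℤˣ) :
    coreAnnulusBC d 2 R R' s_ann s_out 0 = 1 := by
  have h0 : (fun _ : Fin d => (0 : ℤ)) = (0 : Site d) := rfl
  simp [coreAnnulusBC, h0]

end Objects

/-! ### The named fact: the uniform gap (4.12)–(4.13) in `d ≥ 3` -/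

section Fact

/-- **van Enter–Fernández–Sokal 1993, eqs. (4.12)–(4.13) in dimension `d ≥ 3`** (the outcome of
Steps 1 and 2.1–2.4 of §4.3.1 fed into the unfixing Step 3: the numerator `y - x` of (4.9) is
bounded below uniformly). For `d ≥ 3` and `β > β_c(d-1)` there is `η > 0` such that for every `R`
there is `R' > R` with
`⟨exp(+2β ∑_{y∼0} σ_y)⟩^{ξ₋}_{Λ^int_{R'};β,0} - ⟨exp(-2β ∑_{y∼0} σ_y)⟩^{ξ₊}_{Λ^int_{R'};β,0} ≥ η`,
where `Λ^int_{R'} = gpiVolume' d R'` are the internal spins of the cube `Λ_{R'}` (the origin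
frozen), `ξ₊ = coreAnnulusBC d 2 R R' 1 (-1)` is the extremal boundary condition of (4.26)
(image spins `ω'_alt` on `Λ'_R` — so `+` at the origin —, `+` on the annulus `Λ'_{R'} ∖ Λ'_R`,
everything else `-`; the second term is `x = ⟨exp[-2J(…)]⟩₊` of (4.10) in the system
`⟨·⟩^{alt;+;-}_{R,R'}`), and `ξ₋ = -coreAnnulusBC d 2 R R' (-1) 1` is the global spin flip of
the extremal boundary condition of (4.27) (so the first term is `y = ⟨exp[+2J(…)]⟩` of (4.11),
the flip `σ ↦ -σ` of `⟨exp[-2J(…)]⟩` in the system `⟨·⟩^{alt;-;+}_{R,R'}` with the origin's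
image spin `+` — "by symmetry", footnote 48: "Because we have fixed the image spin at the origin
to be `+`, the two situations are not quite symmetric. But the only change is a shift in the
location of the internal spins in `∂_{R+1}` which feel a nonzero effective field; and this is
irrelevant, since we replace these fields by zero anyway"). Printed proof: (4.12)
`y - x = 2⟨sinh 2J(…)⟩ ≥ 16J⟨σ_{0,1}⟩₊` by Griffiths' first inequality, and `⟨σ_{0,1}⟩₊ ≥ c > 0`
uniformly by (4.26), i.e. Steps 2.1–2.4 (weak limits; uniqueness of the Gibbs measure for `+`
image spins — Lee–Yang, Lebowitz–Penrose, Lebowitz' inequality (4.29); FKG comparison with the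
`+` phase of the fully alternating internal system; its spontaneous magnetisation, Step 1: "more
ferromagnetic than the `(d-1)`-dimensional undiluted Ising model"). Named fact, not proved here.
[cite: VanenterFernandezSokal1993, §4.1.2 eqs. (4.9)–(4.13) and §4.3.1 eqs. (4.26)–(4.27), Step 3] -/
def VEFS1993_eq412 : Prop :=
  ∀ d : ℕ, 3 ≤ d → ∀ β : ℝ, criticalBeta (d - 1) < β → ∃ η : ℝ, 0 < η ∧
    ∀ R : ℕ, ∃ R' : ℕ, R < R' ∧
      η ≤ isingExpect (zdGraph d) (gpiVolume' d R') β 0 (.fixed (-coreAnnulusBC d 2 R R' (-1) 1))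
            (fun σ => Real.exp (2 * β * nbrSpinSum (zdGraph d) 0 σ)) -
          isingExpect (zdGraph d) (gpiVolume' d R') β 0 (.fixed (coreAnnulusBC d 2 R R' 1 (-1)))
            (fun σ => Real.exp (-(2 * β * nbrSpinSum (zdGraph d) 0 σ)))

end Fact

/-! ### Step 3 and the FKG reduction: `VEFS1993_eq413` from `VEFS1993_eq412` -/

section Reduction

variable {d : ℕ}

/-- `0 ≤ β` when `β > β_c(d-1)`. [cite: FriedliVelenik2017, Definition 3.29] -/
theorem beta_nonneg_of_criticalBeta_lt {n : ℕ} {β : ℝ} (hβ : criticalBeta n < β) : 0 ≤ β :=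
  (criticalBeta_nonneg n).trans hβ.le

/-- Elementary: for `0 < x ≤ B`, `0 < y ≤ B` and `y - x ≥ η ≥ 0`,
`(1-x)/(1+x) - (1-y)/(1+y) = 2(y-x)/((1+x)(1+y)) ≥ 2η/(1+B)²` ((4.9) with the bound on its
denominator). [cite: VanenterFernandezSokal1993, eq. (4.9)] -/
theorem unfix_gap_bound {x y B η : ℝ} (hx : 0 < x) (hxB : x ≤ B) (hy : 0 < y) (hyB : y ≤ B)
    (hη : 0 ≤ η) (hgap : η ≤ y - x) :
    2 * η / (1 + B) ^ 2 ≤ (1 - x) / (1 + x) - (1 - y) / (1 + y) := by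
  have hB : 0 < 1 + B := by linarith
  have h1 : (1 - x) / (1 + x) - (1 - y) / (1 + y) = 2 * (y - x) / ((1 + x) * (1 + y)) := by
    field_simp
    ring
  rw [h1]
  have hden : (1 + x) * (1 + y) ≤ (1 + B) ^ 2 := by nlinarith
  have hden_pos : 0 < (1 + x) * (1 + y) := by positivity
  calc 2 * η / (1 + B) ^ 2 ≤ 2 * η / ((1 + x) * (1 + y)) :=
        div_le_div_of_nonneg_left (by linarith) hden_pos hden
    _ ≤ 2 * (y - x) / ((1 + x) * (1 + y)) :=
        div_le_div_of_nonneg_right (by linarith) hden_pos.le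

/-- Expectations of `exp(c ∑_{y∼a} σ_y)` lie in `(0, e^{|c| deg a}]`.
[cite: VanenterFernandezSokal1993, §4.1.2 Step 3 (bound on the denominator of (4.9))] -/
theorem isingExpect_exp_nbrSpinSum_pos {W : Type*} (G : SimpleGraph W) [DecidableEq W]
    [G.LocallyFinite] (Λ : Finset W) (β h : ℝ) (bc : BoundaryCondition W) (c : ℝ) (a : W) :
    0 < isingExpect G Λ β h bc (fun σ => Real.exp (c * nbrSpinSum G a σ)) := by
  have hm : Measurable fun σ => Real.exp (c * nbrSpinSum G a σ) :=
    Real.measurable_exp.comp ((measurable_nbrSpinSum G a).const_mul c)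
  rw [isingExpect, integral_isingMeasure G Λ β h bc hm]
  refine div_pos (Finset.sum_pos (fun τ _ => mul_pos (isingWeight_pos G Λ β h bc τ)
    (Real.exp_pos _)) Finset.univ_nonempty) (isingPartitionFunction_pos G Λ β h bc)

/-- `|⟨f⟩| ≤ C` when `‖f‖ ≤ C`. [cite: FriedliVelenik2017, §3.1 eq. (3.8)] -/
theorem norm_isingExpect_le {W : Type*} (G : SimpleGraph W) [DecidableEq W] [G.LocallyFinite]
    (Λ : Finset W) (β h : ℝ) (bc : BoundaryCondition W) {f : SpinConfig W → ℝ} {C : ℝ}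
    (hC : ∀ σ, ‖f σ‖ ≤ C) : ‖isingExpect G Λ β h bc f‖ ≤ C := by
  unfold isingExpect
  simpa using norm_integral_le_of_norm_le_const (μ := isingMeasure G Λ β h bc) (ae_of_all _ hC)

/-- Upper bound `⟨exp(c ∑_{y∼a} σ_y)⟩ ≤ exp(|c| deg a)`.
[cite: VanenterFernandezSokal1993, §4.1.2 Step 3 (bound on the denominator of (4.9))] -/
theorem isingExpect_exp_nbrSpinSum_le {W : Type*} (G : SimpleGraph W) [DecidableEq W]
    [G.LocallyFinite] (Λ : Finset W) (β h : ℝ) (bc : BoundaryCondition W) (c : ℝ) (a : W) :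
    isingExpect G Λ β h bc (fun σ => Real.exp (c * nbrSpinSum G a σ)) ≤
      Real.exp (|c| * G.degree a) := by
  have hbd : ∀ σ, ‖Real.exp (c * nbrSpinSum G a σ)‖ ≤ Real.exp (|c| * G.degree a) := by
    intro σ
    rw [Real.norm_eq_abs, abs_of_pos (Real.exp_pos _)]
    refine Real.exp_le_exp.2 ?_
    calc c * nbrSpinSum G a σ ≤ |c * nbrSpinSum G a σ| := le_abs_self _
      _ = |c| * |nbrSpinSum G a σ| := abs_mul _ _
      _ ≤ |c| * G.degree a := by
          rw [← SimpleGraph.card_neighborFinset_eq_degree]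
          exact mul_le_mul_of_nonneg_left (abs_nbrSpinSum_le G a σ) (abs_nonneg c)
  exact (le_abs_self _).trans ((Real.norm_eq_abs _).symm.le.trans (norm_isingExpect_le G Λ β h bc hbd))

/-- **Step 3 and the FKG reduction, proved: `VEFS1993_eq412 → VEFS1993_eq413`.** Given the
uniform gap `η`, take `W = Λ^int_{R'} ∪ {0}` and `c₊ = (1-x)/(1+x)`, `c₋ = (1-y)/(1+y)` with
`x, y` the two expectations of `VEFS1993_eq412`. For `T₂η ∈ 𝒩_{R,R',+}`, `η ≥ ξ₊` coordinatewise,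
so `⟨σ_0⟩^η_W ≥ ⟨σ_0⟩^{ξ₊}_W` by the FKG monotonicity in the boundary condition
(`isingExpect_fixed_mono` with `coreAnnulusBC_le_of_mem_plusSelected`, the first inequality of
(4.26)), and `⟨σ_0⟩^{ξ₊}_W = (1-x)/(1+x)` by
the unfixing identity (4.7) (`isingExpect_spinAt_eq_unfix`). For `T₂η ∈ 𝒩_{R,R',-}`,
`η ≤ ξ'` (the extremal condition of (4.27)), so `⟨σ_0⟩^η_W ≤ ⟨σ_0⟩^{ξ'}_W = (1-x')/(1+x')`
with `x' = ⟨e^{-2β∑σ}⟩^{ξ'} = ⟨e^{+2β∑σ}⟩^{-ξ'} = y` by the global spin flip (4.8). Finally (4.9):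
`c₊ - c₋ = 2(y-x)/((1+x)(1+y)) ≥ 2η/(1+e^{2β deg 0})² = δ`.
[cite: VanenterFernandezSokal1993, §4.1.2 Step 3 eqs. (4.7)–(4.13) and §4.3.1 eqs. (4.26)–(4.27)] -/
theorem VEFS1993_eq413_of_eq412 (h412 : VEFS1993_eq412) : VEFS1993_eq413 := by
  intro d hd β hβ
  have hβ0 : 0 ≤ β := beta_nonneg_of_criticalBeta_lt hβ
  obtain ⟨η, hη, hR⟩ := h412 d hd β hβ
  set B : ℝ := Real.exp (2 * |β| * ((zdGraph d).degree 0)) with hB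
  refine ⟨2 * η / (1 + B) ^ 2, by positivity, fun R => ?_⟩
  obtain ⟨R', hRR', hgap⟩ := hR R
  have hR'1 : 1 ≤ R' := by omega
  set W' : Finset (Site d) := gpiVolume' d R' with hW'
  set W : Finset (Site d) := insert 0 W' with hW
  have h0W : (0 : Site d) ∈ W := Finset.mem_insert_self 0 W'
  have hWerase : W.erase 0 = W' := Finset.erase_insert (zero_notMem_gpiVolume' R')
  have hN : ∀ y, (zdGraph d).Adj 0 y → y ∈ W.erase 0 := fun y hy => by
    rw [hWerase]; exact mem_gpiVolume'_of_adj_zero hR'1 hy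
  -- the two expectations of the fact
  set x : ℝ := isingExpect (zdGraph d) W' β 0 (.fixed (coreAnnulusBC d 2 R R' 1 (-1)))
    (fun σ => Real.exp (-(2 * β * nbrSpinSum (zdGraph d) 0 σ))) with hx
  set y : ℝ := isingExpect (zdGraph d) W' β 0 (.fixed (-coreAnnulusBC d 2 R R' (-1) 1))
    (fun σ => Real.exp (2 * β * nbrSpinSum (zdGraph d) 0 σ)) with hy
  have habs : |2 * β| = 2 * |β| := by rw [abs_mul, abs_two]
  have hxpos : 0 < x := by
    have := isingExpect_exp_nbrSpinSum_pos (zdGraph d) W' β 0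
      (.fixed (coreAnnulusBC d 2 R R' 1 (-1))) (-(2 * β)) 0
    simpa only [neg_mul] using this
  have hxB : x ≤ B := by
    have := isingExpect_exp_nbrSpinSum_le (zdGraph d) W' β 0
      (.fixed (coreAnnulusBC d 2 R R' 1 (-1))) (-(2 * β)) 0
    simpa only [neg_mul, abs_neg, habs] using this
  have hypos : 0 < y := isingExpect_exp_nbrSpinSum_pos (zdGraph d) W' β 0 _ (2 * β) 0
  have hyB : y ≤ B := by
    have := isingExpect_exp_nbrSpinSum_le (zdGraph d) W' β 0
      (.fixed (-coreAnnulusBC d 2 R R' (-1) 1)) (2 * β) 0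
    simpa only [habs] using this
  refine ⟨R', hRR', W, h0W, fun z hz => ?_, (1 - x) / (1 + x), (1 - y) / (1 + y),
    unfix_gap_bound hxpos hxB hypos hyB hη.le hgap, fun ξ hξ => ?_, fun ξ hξ => ?_⟩
  · -- no doubled site other than the origin in `W`
    rw [hW, Finset.mem_insert, not_or]
    refine ⟨fun h => hz ?_, double_notMem_gpiVolume' R' z⟩
    funext i
    have := congrFun h i
    simp only [Pi.zero_apply, mul_eq_zero] at this
    simpa using this
  · -- lower bound on `𝒩_{R,R',+}`: FKG to the worst case, then unfixing
    have hmono := isingExpect_fixed_mono (zdGraph d) hβ0 W 0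
      (coreAnnulusBC_le_of_mem_plusSelected (b := 2) (by norm_num) hξ) (spinAt_mono 0)
      (measurable_spinAt 0)
    refine le_trans (le_of_eq ?_) hmono
    rw [isingExpect_spinAt_eq_unfix (zdGraph d) h0W hN β (coreAnnulusBC_two_zero R R' 1 (-1)),
      hWerase]
  · -- upper bound on `𝒩_{R,R',-}`: FKG to the worst case, unfixing, spin flip
    have hmono := isingExpect_fixed_mono (zdGraph d) hβ0 W 0
      (le_coreAnnulusBC_of_mem_minusSelected (b := 2) (by norm_num) hξ) (spinAt_mono 0)
      (measurable_spinAt 0)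
    refine hmono.trans (le_of_eq ?_)
    rw [isingExpect_spinAt_eq_unfix (zdGraph d) h0W hN β (coreAnnulusBC_two_zero R R' (-1) 1),
      hWerase]
    have hflip : isingExpect (zdGraph d) W' β 0 (.fixed (coreAnnulusBC d 2 R R' (-1) 1))
        (fun σ => Real.exp (-(2 * β * nbrSpinSum (zdGraph d) 0 σ))) = y := by
      have hm : Measurable fun σ : SpinConfig (Site d) =>
          Real.exp (-(2 * β * nbrSpinSum (zdGraph d) 0 σ)) :=
        Real.measurable_exp.comp ((measurable_nbrSpinSum (zdGraph d) 0).const_mul _).neg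
      have := isingExpect_fixed_neg (zdGraph d) W' β 0 (-coreAnnulusBC d 2 R R' (-1) 1) hm
      rw [neg_zero, neg_neg] at this
      rw [this, hy]
      congr 1
      funext σ
      rw [nbrSpinSum_neg]
      ring_nf
    rw [hflip]

/-- **(4.32) from the uniform gap.** [cite: VanenterFernandezSokal1993, §4.3.1 eq. (4.32) and §4.1.2 Step 3] -/
theorem VEFS1993_eq432_of_eq412 (h412 : VEFS1993_eq412) : VEFS1993_eq432 :=
  VEFS1993_eq432_of_eq413 (VEFS1993_eq413_of_eq412 h412)

/-- **Theorem 4.2 from the uniform gap.** [cite: VanenterFernandezSokal1993, Theorem 4.2] -/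
theorem VEFS1993_thm42_of_eq412 (h412 : VEFS1993_eq412) : VEFS1993_thm42 :=
  VEFS1993_thm42_of_eq413 (VEFS1993_eq413_of_eq412 h412)

/-- **The barrier from the uniform gap**: what remains for `PositionSpaceRGNonGibbsian_holds` is
`VEFS1993_eq412` (Steps 1, 2.1–2.4 of §4.3.1 with (4.12)).
[cite: VanenterFernandezSokal1993, Theorem 4.2] -/
theorem positionSpaceRGNonGibbsian_of_eq412 (h412 : VEFS1993_eq412) : PositionSpaceRGNonGibbsian :=
  positionSpaceRGNonGibbsian_of_eq413 (VEFS1993_eq413_of_eq412 h412)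

end Reduction

end Literature.Barriers.CriticalPhenomena.NonGibbs

end
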